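import Literature.MathematicalPhysics.QuantumLattice.SpinSectorPartitionFnTransfer
import Literature.MathematicalPhysics.QuantumLattice.HubbardUniformOneParticleCost
import HarnessLib

/-!
# The volume-free (bandwidth-rate) one-electron transfer for the spin-sector canonical partition functions

Topic `MathematicalPhysics/QuantumLattice` (family `hubbard`); sharpening of `SpinSectorPartitionFnTransfer.lean`.
There the ratio `Z(a+1,b)/Z(a,b)` of adjacent spin-sector canonical partition functions of a sector-preserving
Hamiltonian was compared with the free-fermion value `(|Λ|−a)/(a+1)` up to a factor `e^{β|Λ|r/(|Λ|−a)}`,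
`r = max_x ‖[H, c†_{x↑}]‖`: the Rayleigh quotient of the orbit sum `Σ_x c_{x↑} [H, c†_{x↑}]` was bounded crudely
by `|Λ| · ‖[H, c†]‖`, which costs a factor volume/(number of holes) `= 2/(2−n)` and the full commutator norm
(`18(2|t|+|U|) + 36|t'|` on the `t–t'` torus). Here the orbit sum is computed: for the Hubbard Hamiltonian
`H = hamiltonian G t U` on a graph of maximal degree `≤ Δ`,

`Σ_z c_{zσ} [H, c†_{zσ}] = −t Σ_{x∼z} c_{zσ} c†_{xσ} + U Σ_z n_{z,−σ} c_{zσ} c†_{zσ}`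
(`= −T_σ + U Σ_z n_{z,−σ}(1 − n_{zσ})`, `T_σ` the spin-`σ` hopping term),

and its Rayleigh quotients are bounded RELATIVE TO THE WEIGHT `W = Σ_z c_{zσ} c†_{zσ}` (`= |Λ| − N_σ`):
`Re⟨w, Σ_z c_z [H, c†_z] w⟩ ≤ (Δ|t| + U⁺) · Re⟨w, W w⟩` for every vector `w` — the hopping part by the graph
Gram bound `|Σ_{x∼z} ⟨φ_z, φ_x⟩| ≤ Δ Σ_z ‖φ_z‖²` applied to `φ_x = c†_{xσ} w`, the interaction part because
`0 ≤ n_{z,−σ} ≤ 1` commutes with `c_{zσ} c†_{zσ}` (`re_rayleigh_orbitSum_creation_le`; removal twin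
`re_rayleigh_orbitSum_annihilation_le` with `U⁻ = max(−U, 0)`). Fed into the tree's orbit-sum transfer
(`orbitSum_transfer_gibbsWeight`, here in the relative form `orbitSum_transfer_gibbsWeight_of_relBound`) this gives the
VOLUME-FREE transfer (`β ≥ 0`, `a < |Λ|`; two-graph Hamiltonian `hamiltonian G t U + hamiltonian G' t' U'` of degrees
`≤ Δ, Δ'`, `κ± = Δ|t| + Δ'|t'| + U± + U'±`):

`(|Λ| − a) Z(a,b) ≤ e^{βκ₊} (a+1) Z(a+1,b)`,  `(a+1) Z(a+1,b) ≤ e^{βκ₋} (|Λ| − a) Z(a,b)`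

(`partitionFn_spinSector_twoGraph_transfer_up_local/_down_local`), i.e. on the `t–t'` torus (`Δ = Δ' = 4`, `U' = 0`,
`κ₊ = 4|t| + 4|t'| + U⁺`, `κ₋ = 4|t| + 4|t'| + U⁻`):

`log((|Λ|−k)/(k+1)) − βκ₊ ≤ log Z(k+1,l) − log Z(k,l) ≤ log((|Λ|−k)/(k+1)) + βκ₋`

(`log_partitionFn_spinSector_hubbardRectTorusTT'_succ_up_mem_local`, `…_succ_down_mem_local`, `…_succ_succ_mem_local`):
the free energy of one added electron is the ideal lattice-gas entropy `log((|Λ|−k)/(k+1))` up to a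
chemical-potential band `[−κ₊, κ₋]` — the bandwidth bound `4|t|+4|t'|` plus the on-site repulsion — uniformly in the
volume and in the filling (Ruelle 1969 §3.4.7: the canonical free energy is Lipschitz in the density with the
one-particle energy bound as constant). Since `log((M−k)/(k+1)) = log C(M,k+1) − log C(M,k)`
(`log_choose_succ_sub_log_choose`), the bracket telescopes exactly against the binomial entropy:

`−2βκ₊ (k'−k) ≤ [log Z(k',k') − 2 log C(|Λ|,k')] − [log Z(k,k) − 2 log C(|Λ|,k)] ≤ 2βκ₋ (k'−k)`  (`k ≤ k' ≤ |Λ|`)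

(`log_partitionFn_sub_log_choose_pairs_mem_local`): the INTERACTION PART of the canonical free entropy is
`2βκ`-Lipschitz in the pair number. The thermodynamic-limit reading for the pressure number `pressureTT'`
(`p(n) − 2H_b(n/2)` is `βκ`-Lipschitz in `n`; sharp density slopes `log((2−n)/n) ± βκ`) is the sequel
`HubbardTTPrimeThermalPressureDensityBand.lean`.

Everything is PROVED; no definition, no named fact.

## Mathlib / tree search

REUSED: `orbitSum_transfer_gibbsWeight` (`GibbsSectorWeightTransfer`); `hamiltonian_mul_creation_sub`,
`hamiltonian_mul_annihilation_sub` (`HubbardUniformOneParticleCost`: `[H, c†_{zτ}] = −tΣ_{x∼z}c†_{xτ} + U n_{z,−τ}c†_{zτ}`);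
`star_mulVec_dotProduct`, `star_dotProduct_eq_inner`, `norm_toLp_sq` (`HubbardOneParticleCost`); the §1 CAR/sector
bookkeeping of `SpinSectorPartitionFnTransfer` (`sum_creation_up_conjTranspose_mul_mul_spinSectorProj`, frame
identities, `re_trace_spinSectorProj_mul_gibbsWeight_eq`, `log_sub_log_mem_of_transfer`), `numberAt_isHermitian`,
`numberAt_idempotent`, `card_filter_fermionRectTorusGraph_adj_le`, `card_filter_fermionRectTorusDiagGraph_adj_le_four`;
Mathlib `Complex.abs_re_le_norm`, `norm_inner_le_norm`, `two_mul_le_add_sq`, `Nat.choose_succ_right_eq`.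
`lean search 'orbitSum.*rel|transfer_up_local|log_choose_succ_sub'`: nothing (2026-08-27).

## References

* D. Ruelle, *Statistical Mechanics: Rigorous Results* (1969), §3.4. [cite: Ruelle1969, §3.4]
* O. Bratteli, D. W. Robinson, *Operator Algebras and Quantum Statistical Mechanics 2* (1997), §6.2.4.
  [cite: BratteliRobinsonII1997, §6.2.4]
-/

noncomputable section

namespace Literature.MathematicalPhysics.QuantumLattice

open Matrix Finset HubbardWave0 LiebThm1 ThermodynamicLimit
open scoped ComplexOrder BigOperators Matrix.Norms.L2Operator InnerProductSpace

/-! ### §1 The relative orbit-sum transfer and the Gram bound on a graph -/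

section Abstract

variable {n : Type*} [Fintype n] [DecidableEq n]

/-- **Relative orbit-sum transfer.** As `orbitSum_transfer_gibbsWeight`, but with the Rayleigh bound of the
commutator orbit sum stated RELATIVE TO THE WEIGHT, `Re⟨w, Σ_o T_oᴴ[K,T_o] w⟩ ≤ κ · Re⟨w, Σ_o T_oᴴT_o w⟩` for all
`w`: then `a · Re tr(P e^{−βK}) ≤ e^{βκ} · Re tr((Σ_o T_o P T_oᴴ) e^{−βK})` — the exponent does not see the volume.
[cite: Ruelle1969, §3.4] -/
theorem orbitSum_transfer_gibbsWeight_of_relBound {O : Type*} [Fintype O] {K P : Matrix n n ℂ}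
    (hK : K.IsHermitian) (hPh : Pᴴ = P) (hPP : P * P = P) (hPK : P * K = K * P) (T : O → Matrix n n ℂ)
    {a κ β : ℝ} (ha : 0 < a) (hβ : 0 ≤ β)
    (hw : (∑ o, (T o)ᴴ * T o) * P = (a : ℂ) • P)
    (hR : ∀ w : n → ℂ, (star w ⬝ᵥ ((∑ o, (T o)ᴴ * (K * T o - T o * K)) *ᵥ w)).re ≤
      κ * (star w ⬝ᵥ ((∑ o, (T o)ᴴ * T o) *ᵥ w)).re) :
    a * ((P * gibbsWeight β K).trace).re ≤
      Real.exp (β * κ) * (((∑ o, T o * P * (T o)ᴴ) * gibbsWeight β K).trace).re := by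
  have hR' : ∀ v : n → ℂ, (star (P *ᵥ v) ⬝ᵥ ((∑ o, (T o)ᴴ * (K * T o - T o * K)) *ᵥ (P *ᵥ v))).re ≤
      κ * a * (star (P *ᵥ v) ⬝ᵥ (P *ᵥ v)).re := by
    intro v
    have hv : (∑ o, (T o)ᴴ * T o) *ᵥ (P *ᵥ v) = (a : ℂ) • (P *ᵥ v) := by
      rw [Matrix.mulVec_mulVec, hw, Matrix.smul_mulVec]
    have h := hR (P *ᵥ v)
    rw [hv, dotProduct_smul, smul_eq_mul, Complex.re_ofReal_mul] at h
    calc _ ≤ κ * (a * (star (P *ᵥ v) ⬝ᵥ (P *ᵥ v)).re) := h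
      _ = κ * a * (star (P *ᵥ v) ⬝ᵥ (P *ᵥ v)).re := by ring
  have h := orbitSum_transfer_gibbsWeight hK hPh hPP hPK T ha hβ (ρ := κ * a) hw hR'
  have e : β * (κ * a) / a = β * κ := by field_simp
  rwa [e] at h

end Abstract

section Gram

variable {m : Type*} [Fintype m]

/-- `2|Re⟨u, v⟩| ≤ ⟨u,u⟩ + ⟨v,v⟩` (Cauchy–Schwarz and AM–GM). [folklore] -/
private theorem two_mul_abs_re_star_dotProduct_le (u v : m → ℂ) :
    2 * |(star u ⬝ᵥ v).re| ≤ (star u ⬝ᵥ u).re + (star v ⬝ᵥ v).re := by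
  rw [← norm_toLp_sq u, ← norm_toLp_sq v]
  have h1 : |(star u ⬝ᵥ v).re| ≤
      ‖(WithLp.toLp 2 u : EuclideanSpace ℂ m)‖ * ‖(WithLp.toLp 2 v : EuclideanSpace ℂ m)‖ :=
    calc |(star u ⬝ᵥ v).re| ≤ ‖star u ⬝ᵥ v‖ := Complex.abs_re_le_norm _
      _ ≤ _ := by rw [star_dotProduct_eq_inner]; exact norm_inner_le_norm _ _
  nlinarith [two_mul_le_add_sq ‖(WithLp.toLp 2 u : EuclideanSpace ℂ m)‖ ‖(WithLp.toLp 2 v : EuclideanSpace ℂ m)‖]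

/-- `0 ≤ Re⟨u, u⟩`. [folklore] -/
private theorem re_star_dotProduct_self_nonneg' (u : m → ℂ) : 0 ≤ (star u ⬝ᵥ u).re := by
  rw [← norm_toLp_sq]; positivity

variable {Λ : Type*} [Fintype Λ] (G : SimpleGraph Λ) [DecidableRel G.Adj]

/-- **The Gram bound on a graph of maximal degree `≤ Δ`**: `|Re Σ_{x∼y} ⟨φ_x, φ_y⟩| ≤ Δ Σ_x ‖φ_x‖²` (each ordered
adjacent pair contributes at most `(‖φ_x‖² + ‖φ_y‖²)/2`, and every vertex lies on at most `Δ` pairs in either slot).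
[folklore] -/
private theorem abs_re_sum_sum_adj_star_dotProduct_le {Δ : ℕ} (hΔ : ∀ x : Λ, #{y | G.Adj x y} ≤ Δ) (φ : Λ → m → ℂ) :
    |(∑ x, ∑ y, if G.Adj x y then star (φ x) ⬝ᵥ φ y else 0).re| ≤ Δ * ∑ x, (star (φ x) ⬝ᵥ φ x).re := by
  set A : Λ → ℝ := fun x => (star (φ x) ⬝ᵥ φ x).re with hA
  have hA0 : ∀ x, 0 ≤ A x := fun x => re_star_dotProduct_self_nonneg' (φ x)
  have hterm : ∀ x y, |(if G.Adj x y then star (φ x) ⬝ᵥ φ y else (0 : ℂ)).re| ≤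
      (if G.Adj x y then A x / 2 else 0) + (if G.Adj x y then A y / 2 else 0) := by
    intro x y
    split_ifs with h
    · have h2 : 2 * |(star (φ x) ⬝ᵥ φ y).re| ≤ A x + A y := two_mul_abs_re_star_dotProduct_le (φ x) (φ y)
      linarith
    · simp
  have hrow : ∀ x, ∑ y, (if G.Adj x y then A x / 2 else 0) ≤ Δ * (A x / 2) := by
    intro x
    rw [← Finset.sum_filter, Finset.sum_const, nsmul_eq_mul]
    exact mul_le_mul_of_nonneg_right (by exact_mod_cast hΔ x) (by linarith [hA0 x])
  have hcol : ∀ y, ∑ x, (if G.Adj x y then A y / 2 else 0) ≤ Δ * (A y / 2) := by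
    intro y
    have e : (∑ x, if G.Adj x y then A y / 2 else (0 : ℝ)) = ∑ x, if G.Adj y x then A y / 2 else 0 :=
      Finset.sum_congr rfl fun x _ => by
        by_cases h : G.Adj x y
        · rw [if_pos h, if_pos h.symm]
        · rw [if_neg h, if_neg fun h' => h h'.symm]
    rw [e, ← Finset.sum_filter, Finset.sum_const, nsmul_eq_mul]
    exact mul_le_mul_of_nonneg_right (by exact_mod_cast hΔ y) (by linarith [hA0 y])
  rw [Complex.re_sum]
  calc |∑ x, (∑ y, if G.Adj x y then star (φ x) ⬝ᵥ φ y else (0 : ℂ)).re|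
      ≤ ∑ x, |(∑ y, if G.Adj x y then star (φ x) ⬝ᵥ φ y else (0 : ℂ)).re| := Finset.abs_sum_le_sum_abs _ _
    _ ≤ ∑ x, ∑ y, ((if G.Adj x y then A x / 2 else 0) + (if G.Adj x y then A y / 2 else 0)) := by
        refine Finset.sum_le_sum fun x _ => ?_
        rw [Complex.re_sum]
        exact (Finset.abs_sum_le_sum_abs _ _).trans (Finset.sum_le_sum fun y _ => hterm x y)
    _ = ∑ x, ∑ y, (if G.Adj x y then A x / 2 else 0) + ∑ x, ∑ y, (if G.Adj x y then A y / 2 else 0) := by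
        rw [← Finset.sum_add_distrib]
        exact Finset.sum_congr rfl fun x _ => Finset.sum_add_distrib
    _ ≤ ∑ x, Δ * (A x / 2) + ∑ y, Δ * (A y / 2) :=
        add_le_add (Finset.sum_le_sum fun x _ => hrow x)
          (by rw [Finset.sum_comm]; exact Finset.sum_le_sum fun y _ => hcol y)
    _ = Δ * ∑ x, A x := by rw [← Finset.mul_sum, ← Finset.sum_div]; ring

/-- For an orthogonal projection `N` (`Nᴴ = N`, `N² = N`): `0 ≤ Re⟨u, N u⟩ ≤ Re⟨u, u⟩`. [folklore] -/
private theorem re_star_dotProduct_proj_mulVec_mem [DecidableEq m] {N : Matrix m m ℂ} (hNh : Nᴴ = N) (hNN : N * N = N)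
    (u : m → ℂ) :
    0 ≤ (star u ⬝ᵥ (N *ᵥ u)).re ∧ (star u ⬝ᵥ (N *ᵥ u)).re ≤ (star u ⬝ᵥ u).re := by
  have key : ∀ {Q : Matrix m m ℂ}, Qᴴ = Q → Q * Q = Q → 0 ≤ (star u ⬝ᵥ (Q *ᵥ u)).re := by
    intro Q hQh hQQ
    have e : star u ⬝ᵥ (Q *ᵥ u) = star (Q *ᵥ u) ⬝ᵥ (Q *ᵥ u) := by
      rw [star_mulVec_dotProduct, hQh, Matrix.mulVec_mulVec, hQQ]
    rw [e]
    exact re_star_dotProduct_self_nonneg' _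
  refine ⟨key hNh hNN, ?_⟩
  have h1h : (1 - N)ᴴ = 1 - N := by rw [conjTranspose_sub, conjTranspose_one, hNh]
  have h11 : (1 - N) * (1 - N) = 1 - N := by
    rw [Matrix.sub_mul, Matrix.mul_sub, Matrix.mul_sub, Matrix.one_mul, Matrix.one_mul, Matrix.mul_one, hNN]
    abel
  have h := key h1h h11
  rw [Matrix.sub_mulVec, Matrix.one_mulVec, dotProduct_sub, Complex.sub_re] at h
  linarith

end Gram

/-! ### §2 The commutator orbit sums of the Hubbard Hamiltonian, relative to the weight -/

section Hubbard

variable {Λ : Type*} [LinearOrder Λ] [Fintype Λ] (G : SimpleGraph Λ) [DecidableRel G.Adj]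

/-- `⟨w, (Aᴴ B) w⟩ = ⟨A w, B w⟩`. [folklore] -/
private theorem star_dotProduct_conjTranspose_mul_mulVec₂ {m : Type*} [Fintype m] (A B : Matrix m m ℂ) (w : m → ℂ) :
    star w ⬝ᵥ ((Aᴴ * B) *ᵥ w) = star (A *ᵥ w) ⬝ᵥ (B *ᵥ w) := by
  rw [star_mulVec_dotProduct, Matrix.mulVec_mulVec]

/-- The scalar `U · r` with `0 ≤ r ≤ s` is at most `max(U,0) · s`. [folklore] -/
private theorem mul_le_max_mul_of_mem {U r s : ℝ} (h0 : 0 ≤ r) (hrs : r ≤ s) : U * r ≤ max U 0 * s := by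
  rcases le_or_gt 0 U with hU | hU
  · rw [max_eq_left hU]; exact mul_le_mul_of_nonneg_left hrs hU
  · rw [max_eq_right hU.le, zero_mul]; exact mul_nonpos_of_nonpos_of_nonneg hU.le h0

/-- **Adding a spin-`τ` electron, per site.** With `u_x = c†_{xτ} w`:
`Re⟨w, c_{zτ}[H, c†_{zτ}] w⟩ ≤ −t · Re Σ_{x∼z} ⟨u_z, u_x⟩ + U⁺ ‖u_z‖²` for `H = hamiltonian G t U`
(`[H, c†_{zτ}] = −t Σ_{x∼z} c†_{xτ} + U n_{z,−τ} c†_{zτ}` and `0 ≤ n_{z,−τ} ≤ 1`). [cite: Ruelle1969, §3.4] -/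
theorem re_rayleigh_annihilation_commutator_creation_le (t U : ℝ) (z : Λ) (τ : Fin 2) (w : Fock (Orb Λ)) :
    (star w ⬝ᵥ (((creation (orb z τ))ᴴ *
        (hamiltonian G t U * creation (orb z τ) - creation (orb z τ) * hamiltonian G t U)) *ᵥ w)).re ≤
      -t * (∑ x : Λ, if G.Adj z x then
          star (creation (orb z τ) *ᵥ w) ⬝ᵥ (creation (orb x τ) *ᵥ w) else 0).re +
        max U 0 * (star (creation (orb z τ) *ᵥ w) ⬝ᵥ (creation (orb z τ) *ᵥ w)).re := by
  obtain ⟨τ', hne, hcomm⟩ := hamiltonian_mul_creation_sub G t U z τ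
  rw [hcomm, star_dotProduct_conjTranspose_mul_mulVec₂, Matrix.add_mulVec, Matrix.smul_mulVec,
    Matrix.smul_mulVec, dotProduct_add, dotProduct_smul, dotProduct_smul, Matrix.sum_mulVec,
    dotProduct_sum, Complex.add_re, smul_eq_mul, smul_eq_mul, ← Matrix.mulVec_mulVec]
  set u : Λ → Fock (Orb Λ) := fun x => creation (orb x τ) *ᵥ w with hu
  have hsum : (∑ x : Λ, star (u z) ⬝ᵥ ((if G.Adj x z then creation (orb x τ) else 0) *ᵥ w)) =
      ∑ x : Λ, if G.Adj z x then star (u z) ⬝ᵥ u x else 0 := by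
    refine Finset.sum_congr rfl fun x _ => ?_
    by_cases h : G.Adj x z
    · rw [if_pos h, if_pos h.symm]
    · rw [if_neg h, if_neg fun h' => h h'.symm, Matrix.zero_mulVec, dotProduct_zero]
  rw [hsum]
  have ht : (-(t : ℂ) * ∑ x : Λ, if G.Adj z x then star (u z) ⬝ᵥ u x else 0).re =
      -t * (∑ x : Λ, if G.Adj z x then star (u z) ⬝ᵥ u x else 0).re := by
    rw [← Complex.ofReal_neg, Complex.re_ofReal_mul]
  rw [ht, Complex.re_ofReal_mul]
  have hn := re_star_dotProduct_proj_mulVec_mem (numberAt_isHermitian (orb z τ')).eq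
    (numberAt_idempotent (orb z τ')).eq (u z)
  have hU := mul_le_max_mul_of_mem (U := U) hn.1 hn.2
  have e : (numberOp z τ' : Matrix (Finset (Orb Λ)) (Finset (Orb Λ)) ℂ) = numberAt (orb z τ') := rfl
  rw [e]
  linarith

/-- **Removing a spin-`τ` electron, per site.** With `v_x = c_{xτ} w`:
`Re⟨w, c†_{zτ}[H, c_{zτ}] w⟩ ≤ t · Re Σ_{x∼z} ⟨v_z, v_x⟩ + U⁻ ‖v_z‖²`, `U⁻ = max(−U, 0)`
(`[H, c_{zτ}] = t Σ_{x∼z} c_{xτ} − U n_{z,−τ} c_{zτ}`). [cite: Ruelle1969, §3.4] -/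
theorem re_rayleigh_creation_commutator_annihilation_le (t U : ℝ) (z : Λ) (τ : Fin 2) (w : Fock (Orb Λ)) :
    (star w ⬝ᵥ (((annihilation (orb z τ))ᴴ *
        (hamiltonian G t U * annihilation (orb z τ) - annihilation (orb z τ) * hamiltonian G t U)) *ᵥ w)).re ≤
      t * (∑ x : Λ, if G.Adj z x then
          star (annihilation (orb z τ) *ᵥ w) ⬝ᵥ (annihilation (orb x τ) *ᵥ w) else 0).re +
        max (-U) 0 * (star (annihilation (orb z τ) *ᵥ w) ⬝ᵥ (annihilation (orb z τ) *ᵥ w)).re := by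
  obtain ⟨τ', hne, hcomm⟩ := hamiltonian_mul_annihilation_sub G t U z τ
  rw [hcomm, star_dotProduct_conjTranspose_mul_mulVec₂, Matrix.sub_mulVec, Matrix.smul_mulVec,
    Matrix.smul_mulVec, dotProduct_sub, dotProduct_smul, dotProduct_smul, Matrix.sum_mulVec,
    dotProduct_sum, Complex.sub_re, smul_eq_mul, smul_eq_mul, ← Matrix.mulVec_mulVec]
  set u : Λ → Fock (Orb Λ) := fun x => annihilation (orb x τ) *ᵥ w with hu
  have hsum : (∑ x : Λ, star (u z) ⬝ᵥ ((if G.Adj x z then annihilation (orb x τ) else 0) *ᵥ w)) =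
      ∑ x : Λ, if G.Adj z x then star (u z) ⬝ᵥ u x else 0 := by
    refine Finset.sum_congr rfl fun x _ => ?_
    by_cases h : G.Adj x z
    · rw [if_pos h, if_pos h.symm]
    · rw [if_neg h, if_neg fun h' => h h'.symm, Matrix.zero_mulVec, dotProduct_zero]
  rw [hsum, Complex.re_ofReal_mul, Complex.re_ofReal_mul]
  have hn := re_star_dotProduct_proj_mulVec_mem (numberAt_isHermitian (orb z τ')).eq
    (numberAt_idempotent (orb z τ')).eq (u z)
  have hU := mul_le_max_mul_of_mem (U := -U) hn.1 hn.2
  have e : (numberOp z τ' : Matrix (Finset (Orb Λ)) (Finset (Orb Λ)) ℂ) = numberAt (orb z τ') := rfl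
  rw [e]
  linarith

/-- **The adding orbit sum relative to the weight.** On a graph of maximal degree `≤ Δ`,
`Re⟨w, Σ_z c_{zτ}[H, c†_{zτ}] w⟩ ≤ (Δ|t| + U⁺) · Re⟨w, Σ_z c_{zτ}c†_{zτ} w⟩` for every `w` (`H = hamiltonian G t U`).
[cite: Ruelle1969, §3.4] -/
theorem re_rayleigh_orbitSum_creation_le {Δ : ℕ} (hΔ : ∀ x : Λ, #{y | G.Adj x y} ≤ Δ) (t U : ℝ) (τ : Fin 2)
    (w : Fock (Orb Λ)) :
    (star w ⬝ᵥ ((∑ z : Λ, (creation (orb z τ))ᴴ *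
        (hamiltonian G t U * creation (orb z τ) - creation (orb z τ) * hamiltonian G t U)) *ᵥ w)).re ≤
      (Δ * |t| + max U 0) *
        (star w ⬝ᵥ ((∑ z : Λ, (creation (orb z τ))ᴴ * creation (orb z τ)) *ᵥ w)).re := by
  set u : Λ → Fock (Orb Λ) := fun x => creation (orb x τ) *ᵥ w with hu
  have hW : (star w ⬝ᵥ ((∑ z : Λ, (creation (orb z τ))ᴴ * creation (orb z τ)) *ᵥ w)).re =
      ∑ z : Λ, (star (u z) ⬝ᵥ u z).re := by
    rw [Matrix.sum_mulVec, dotProduct_sum, Complex.re_sum]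
    exact Finset.sum_congr rfl fun z _ => by rw [star_dotProduct_conjTranspose_mul_mulVec₂]
  rw [Matrix.sum_mulVec, dotProduct_sum, Complex.re_sum, hW]
  have hz := fun z => re_rayleigh_annihilation_commutator_creation_le G t U z τ w
  have hgram := abs_re_sum_sum_adj_star_dotProduct_le G hΔ u
  have ht : -t * (∑ z : Λ, ∑ x : Λ, if G.Adj z x then star (u z) ⬝ᵥ u x else (0 : ℂ)).re ≤
      Δ * |t| * ∑ z : Λ, (star (u z) ⬝ᵥ u z).re := by
    have h1 : -t * (∑ z : Λ, ∑ x : Λ, if G.Adj z x then star (u z) ⬝ᵥ u x else (0 : ℂ)).re ≤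
        |t| * |(∑ z : Λ, ∑ x : Λ, if G.Adj z x then star (u z) ⬝ᵥ u x else (0 : ℂ)).re| := by
      rw [← abs_neg t]
      exact (le_abs_self _).trans (abs_mul _ _).le
    calc _ ≤ _ := h1
      _ ≤ |t| * (Δ * ∑ z : Λ, (star (u z) ⬝ᵥ u z).re) := mul_le_mul_of_nonneg_left hgram (abs_nonneg t)
      _ = _ := by ring
  calc ∑ z : Λ, (star w ⬝ᵥ (((creation (orb z τ))ᴴ *
          (hamiltonian G t U * creation (orb z τ) - creation (orb z τ) * hamiltonian G t U)) *ᵥ w)).re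
      ≤ ∑ z : Λ, (-t * (∑ x : Λ, if G.Adj z x then star (u z) ⬝ᵥ u x else 0).re +
          max U 0 * (star (u z) ⬝ᵥ u z).re) := Finset.sum_le_sum fun z _ => hz z
    _ = -t * (∑ z : Λ, ∑ x : Λ, if G.Adj z x then star (u z) ⬝ᵥ u x else (0 : ℂ)).re +
          max U 0 * ∑ z : Λ, (star (u z) ⬝ᵥ u z).re := by
        rw [Finset.sum_add_distrib, Complex.re_sum, Finset.mul_sum, Finset.mul_sum]
    _ ≤ Δ * |t| * ∑ z : Λ, (star (u z) ⬝ᵥ u z).re + max U 0 * ∑ z : Λ, (star (u z) ⬝ᵥ u z).re :=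
        add_le_add ht le_rfl
    _ = (Δ * |t| + max U 0) * ∑ z : Λ, (star (u z) ⬝ᵥ u z).re := by ring

/-- **The removing orbit sum relative to the weight.** On a graph of maximal degree `≤ Δ`,
`Re⟨w, Σ_z c†_{zτ}[H, c_{zτ}] w⟩ ≤ (Δ|t| + U⁻) · Re⟨w, Σ_z n_{zτ} w⟩` for every `w`. [cite: Ruelle1969, §3.4] -/
theorem re_rayleigh_orbitSum_annihilation_le {Δ : ℕ} (hΔ : ∀ x : Λ, #{y | G.Adj x y} ≤ Δ) (t U : ℝ)
    (τ : Fin 2) (w : Fock (Orb Λ)) :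
    (star w ⬝ᵥ ((∑ z : Λ, (annihilation (orb z τ))ᴴ *
        (hamiltonian G t U * annihilation (orb z τ) - annihilation (orb z τ) * hamiltonian G t U)) *ᵥ w)).re ≤
      (Δ * |t| + max (-U) 0) *
        (star w ⬝ᵥ ((∑ z : Λ, (annihilation (orb z τ))ᴴ * annihilation (orb z τ)) *ᵥ w)).re := by
  set u : Λ → Fock (Orb Λ) := fun x => annihilation (orb x τ) *ᵥ w with hu
  have hW : (star w ⬝ᵥ ((∑ z : Λ, (annihilation (orb z τ))ᴴ * annihilation (orb z τ)) *ᵥ w)).re =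
      ∑ z : Λ, (star (u z) ⬝ᵥ u z).re := by
    rw [Matrix.sum_mulVec, dotProduct_sum, Complex.re_sum]
    exact Finset.sum_congr rfl fun z _ => by rw [star_dotProduct_conjTranspose_mul_mulVec₂]
  rw [Matrix.sum_mulVec, dotProduct_sum, Complex.re_sum, hW]
  have hz := fun z => re_rayleigh_creation_commutator_annihilation_le G t U z τ w
  have hgram := abs_re_sum_sum_adj_star_dotProduct_le G hΔ u
  have ht : t * (∑ z : Λ, ∑ x : Λ, if G.Adj z x then star (u z) ⬝ᵥ u x else (0 : ℂ)).re ≤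
      Δ * |t| * ∑ z : Λ, (star (u z) ⬝ᵥ u z).re := by
    have h1 : t * (∑ z : Λ, ∑ x : Λ, if G.Adj z x then star (u z) ⬝ᵥ u x else (0 : ℂ)).re ≤
        |t| * |(∑ z : Λ, ∑ x : Λ, if G.Adj z x then star (u z) ⬝ᵥ u x else (0 : ℂ)).re| :=
      (le_abs_self _).trans (abs_mul _ _).le
    calc _ ≤ _ := h1
      _ ≤ |t| * (Δ * ∑ z : Λ, (star (u z) ⬝ᵥ u z).re) := mul_le_mul_of_nonneg_left hgram (abs_nonneg t)
      _ = _ := by ring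
  calc ∑ z : Λ, (star w ⬝ᵥ (((annihilation (orb z τ))ᴴ *
          (hamiltonian G t U * annihilation (orb z τ) - annihilation (orb z τ) * hamiltonian G t U)) *ᵥ w)).re
      ≤ ∑ z : Λ, (t * (∑ x : Λ, if G.Adj z x then star (u z) ⬝ᵥ u x else 0).re +
          max (-U) 0 * (star (u z) ⬝ᵥ u z).re) := Finset.sum_le_sum fun z _ => hz z
    _ = t * (∑ z : Λ, ∑ x : Λ, if G.Adj z x then star (u z) ⬝ᵥ u x else (0 : ℂ)).re +
          max (-U) 0 * ∑ z : Λ, (star (u z) ⬝ᵥ u z).re := by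
        rw [Finset.sum_add_distrib, Complex.re_sum, Finset.mul_sum, Finset.mul_sum]
    _ ≤ Δ * |t| * ∑ z : Λ, (star (u z) ⬝ᵥ u z).re + max (-U) 0 * ∑ z : Λ, (star (u z) ⬝ᵥ u z).re :=
        add_le_add ht le_rfl
    _ = (Δ * |t| + max (-U) 0) * ∑ z : Λ, (star (u z) ⬝ᵥ u z).re := by ring

/-- The commutator orbit sum is additive in the Hamiltonian. [folklore] -/
private theorem orbitSum_commutator_add {m O : Type*} [Fintype m] [Fintype O] (T : O → Matrix m m ℂ)
    (K₁ K₂ : Matrix m m ℂ) :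
    ∑ o, (T o)ᴴ * ((K₁ + K₂) * T o - T o * (K₁ + K₂)) =
      ∑ o, (T o)ᴴ * (K₁ * T o - T o * K₁) + ∑ o, (T o)ᴴ * (K₂ * T o - T o * K₂) := by
  rw [← Finset.sum_add_distrib]
  refine Finset.sum_congr rfl fun o _ => ?_
  rw [← Matrix.mul_add]
  congr 1
  rw [Matrix.add_mul, Matrix.mul_add]
  abel

variable (G' : SimpleGraph Λ) [DecidableRel G'.Adj]

/-- **Two-graph adding orbit sum** (`H = hamiltonian G t U + hamiltonian G' t' U'`, degrees `≤ Δ, Δ'`):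
`Re⟨w, Σ_z c_{zτ}[H, c†_{zτ}] w⟩ ≤ (Δ|t| + U⁺ + Δ'|t'| + U'⁺) · Re⟨w, Σ_z c_{zτ}c†_{zτ} w⟩`. [cite: Ruelle1969, §3.4] -/
theorem re_rayleigh_orbitSum_creation_twoGraph_le {Δ Δ' : ℕ} (hΔ : ∀ x : Λ, #{y | G.Adj x y} ≤ Δ)
    (hΔ' : ∀ x : Λ, #{y | G'.Adj x y} ≤ Δ') (t U t' U' : ℝ) (τ : Fin 2) (w : Fock (Orb Λ)) :
    (star w ⬝ᵥ ((∑ z : Λ, (creation (orb z τ))ᴴ *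
        ((hamiltonian G t U + hamiltonian G' t' U') * creation (orb z τ) -
          creation (orb z τ) * (hamiltonian G t U + hamiltonian G' t' U'))) *ᵥ w)).re ≤
      (Δ * |t| + max U 0 + (Δ' * |t'| + max U' 0)) *
        (star w ⬝ᵥ ((∑ z : Λ, (creation (orb z τ))ᴴ * creation (orb z τ)) *ᵥ w)).re := by
  rw [orbitSum_commutator_add, Matrix.add_mulVec, dotProduct_add, Complex.add_re, add_mul]
  exact add_le_add (re_rayleigh_orbitSum_creation_le G hΔ t U τ w)
    (re_rayleigh_orbitSum_creation_le G' hΔ' t' U' τ w)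

/-- **Two-graph removing orbit sum**:
`Re⟨w, Σ_z c†_{zτ}[H, c_{zτ}] w⟩ ≤ (Δ|t| + U⁻ + Δ'|t'| + U'⁻) · Re⟨w, Σ_z n_{zτ} w⟩`. [cite: Ruelle1969, §3.4] -/
theorem re_rayleigh_orbitSum_annihilation_twoGraph_le {Δ Δ' : ℕ} (hΔ : ∀ x : Λ, #{y | G.Adj x y} ≤ Δ)
    (hΔ' : ∀ x : Λ, #{y | G'.Adj x y} ≤ Δ') (t U t' U' : ℝ) (τ : Fin 2) (w : Fock (Orb Λ)) :
    (star w ⬝ᵥ ((∑ z : Λ, (annihilation (orb z τ))ᴴ *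
        ((hamiltonian G t U + hamiltonian G' t' U') * annihilation (orb z τ) -
          annihilation (orb z τ) * (hamiltonian G t U + hamiltonian G' t' U'))) *ᵥ w)).re ≤
      (Δ * |t| + max (-U) 0 + (Δ' * |t'| + max (-U') 0)) *
        (star w ⬝ᵥ ((∑ z : Λ, (annihilation (orb z τ))ᴴ * annihilation (orb z τ)) *ᵥ w)).re := by
  rw [orbitSum_commutator_add, Matrix.add_mulVec, dotProduct_add, Complex.add_re, add_mul]
  exact add_le_add (re_rayleigh_orbitSum_annihilation_le G hΔ t U τ w)
    (re_rayleigh_orbitSum_annihilation_le G' hΔ' t' U' τ w)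

end Hubbard

/-! ### §3 The volume-free transfer -/

namespace ThermodynamicLimit

section TwoGraph

variable {Λ : Type*} [LinearOrder Λ] [Fintype Λ] (G G' : SimpleGraph Λ) [DecidableRel G.Adj] [DecidableRel G'.Adj]

/-- **Volume-free spin-up transfer for the two-graph Hubbard Hamiltonian** `H = hamiltonian G t U + hamiltonian G' t' U'`
(degrees `≤ Δ, Δ'`; `κ± = Δ|t| + U± + Δ'|t'| + U'±`), `β ≥ 0`, `a < |Λ|`:
`(|Λ| − a) Z(a,b) ≤ e^{βκ₊} (a+1) Z(a+1,b)` and `(a+1) Z(a+1,b) ≤ e^{βκ₋} (|Λ| − a) Z(a,b)`.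
[cite: Ruelle1969, §3.4] [cite: BratteliRobinsonII1997, §6.2.4] -/
theorem partitionFn_spinSector_twoGraph_transfer_up_local {Δ Δ' : ℕ} (hΔ : ∀ x : Λ, #{y | G.Adj x y} ≤ Δ)
    (hΔ' : ∀ x : Λ, #{y | G'.Adj x y} ≤ Δ') (t U t' U' : ℝ) {β : ℝ} (hβ : 0 ≤ β) {a : ℕ}
    (ha : a < Fintype.card Λ) (b : ℕ) :
    ((Fintype.card Λ : ℝ) - a) *
          (partitionFn β (spinSectorHamiltonian a b (hamiltonian G t U + hamiltonian G' t' U'))).re ≤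
        Real.exp (β * (Δ * |t| + max U 0 + (Δ' * |t'| + max U' 0))) *
          (((a : ℝ) + 1) *
            (partitionFn β (spinSectorHamiltonian (a + 1) b (hamiltonian G t U + hamiltonian G' t' U'))).re) ∧
      ((a : ℝ) + 1) *
          (partitionFn β (spinSectorHamiltonian (a + 1) b (hamiltonian G t U + hamiltonian G' t' U'))).re ≤
        Real.exp (β * (Δ * |t| + max (-U) 0 + (Δ' * |t'| + max (-U') 0))) *
          (((Fintype.card Λ : ℝ) - a) *
            (partitionFn β (spinSectorHamiltonian a b (hamiltonian G t U + hamiltonian G' t' U'))).re) := by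
  set H := hamiltonian G t U + hamiltonian G' t' U' with hHdef
  have hH : H.IsHermitian := (hamiltonian_isHermitian G t U).add (hamiltonian_isHermitian G' t' U')
  have hP : PreservesSectors H := (preservesSectors_hamiltonian G t U).add (preservesSectors_hamiltonian G' t' U')
  have ha0 : (0 : ℝ) < (Fintype.card Λ : ℝ) - a := by
    have : (a : ℝ) + 1 ≤ Fintype.card Λ := by exact_mod_cast ha
    linarith
  refine ⟨?_, ?_⟩
  · have h := orbitSum_transfer_gibbsWeight_of_relBound (O := Λ) hH (spinSectorProj_conjTranspose a b)
      (spinSectorProj_mul_self a b) (spinSectorProj_mul_comm_of_preservesSectors hP a b)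
      (fun x => creation (orb x 0)) ha0 hβ
      (sum_creation_up_conjTranspose_mul_mul_spinSectorProj a b)
      (fun w => re_rayleigh_orbitSum_creation_twoGraph_le G G' hΔ hΔ' t U t' U' 0 w)
    rw [sum_creation_up_mul_spinSectorProj_mul_conjTranspose, Matrix.smul_mul, Matrix.trace_smul, smul_eq_mul,
      Complex.re_ofReal_mul, re_trace_spinSectorProj_mul_gibbsWeight_eq hP,
      re_trace_spinSectorProj_mul_gibbsWeight_eq hP] at h
    exact h
  · have ha1 : (0 : ℝ) < (a : ℝ) + 1 := by positivity
    have h := orbitSum_transfer_gibbsWeight_of_relBound (O := Λ) hH (spinSectorProj_conjTranspose (a + 1) b)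
      (spinSectorProj_mul_self (a + 1) b) (spinSectorProj_mul_comm_of_preservesSectors hP (a + 1) b)
      (fun x => annihilation (orb x 0)) ha1 hβ
      (sum_annihilation_up_conjTranspose_mul_mul_spinSectorProj a b)
      (fun w => re_rayleigh_orbitSum_annihilation_twoGraph_le G G' hΔ hΔ' t U t' U' 0 w)
    rw [sum_annihilation_up_mul_spinSectorProj_mul_conjTranspose, Matrix.smul_mul, Matrix.trace_smul, smul_eq_mul,
      Complex.re_ofReal_mul, re_trace_spinSectorProj_mul_gibbsWeight_eq hP,
      re_trace_spinSectorProj_mul_gibbsWeight_eq hP] at h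
    exact h

/-- **Volume-free spin-down transfer for the two-graph Hubbard Hamiltonian** (`b < |Λ|`). [cite: Ruelle1969, §3.4] -/
theorem partitionFn_spinSector_twoGraph_transfer_down_local {Δ Δ' : ℕ} (hΔ : ∀ x : Λ, #{y | G.Adj x y} ≤ Δ)
    (hΔ' : ∀ x : Λ, #{y | G'.Adj x y} ≤ Δ') (t U t' U' : ℝ) {β : ℝ} (hβ : 0 ≤ β) (a : ℕ) {b : ℕ}
    (hb : b < Fintype.card Λ) :
    ((Fintype.card Λ : ℝ) - b) *
          (partitionFn β (spinSectorHamiltonian a b (hamiltonian G t U + hamiltonian G' t' U'))).re ≤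
        Real.exp (β * (Δ * |t| + max U 0 + (Δ' * |t'| + max U' 0))) *
          (((b : ℝ) + 1) *
            (partitionFn β (spinSectorHamiltonian a (b + 1) (hamiltonian G t U + hamiltonian G' t' U'))).re) ∧
      ((b : ℝ) + 1) *
          (partitionFn β (spinSectorHamiltonian a (b + 1) (hamiltonian G t U + hamiltonian G' t' U'))).re ≤
        Real.exp (β * (Δ * |t| + max (-U) 0 + (Δ' * |t'| + max (-U') 0))) *
          (((Fintype.card Λ : ℝ) - b) *
            (partitionFn β (spinSectorHamiltonian a b (hamiltonian G t U + hamiltonian G' t' U'))).re) := by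
  set H := hamiltonian G t U + hamiltonian G' t' U' with hHdef
  have hH : H.IsHermitian := (hamiltonian_isHermitian G t U).add (hamiltonian_isHermitian G' t' U')
  have hP : PreservesSectors H := (preservesSectors_hamiltonian G t U).add (preservesSectors_hamiltonian G' t' U')
  have hb0 : (0 : ℝ) < (Fintype.card Λ : ℝ) - b := by
    have : (b : ℝ) + 1 ≤ Fintype.card Λ := by exact_mod_cast hb
    linarith
  refine ⟨?_, ?_⟩
  · have h := orbitSum_transfer_gibbsWeight_of_relBound (O := Λ) hH (spinSectorProj_conjTranspose a b)
      (spinSectorProj_mul_self a b) (spinSectorProj_mul_comm_of_preservesSectors hP a b)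
      (fun x => creation (orb x 1)) hb0 hβ
      (sum_creation_down_conjTranspose_mul_mul_spinSectorProj a b)
      (fun w => re_rayleigh_orbitSum_creation_twoGraph_le G G' hΔ hΔ' t U t' U' 1 w)
    rw [sum_creation_down_mul_spinSectorProj_mul_conjTranspose, Matrix.smul_mul, Matrix.trace_smul, smul_eq_mul,
      Complex.re_ofReal_mul, re_trace_spinSectorProj_mul_gibbsWeight_eq hP,
      re_trace_spinSectorProj_mul_gibbsWeight_eq hP] at h
    exact h
  · have hb1 : (0 : ℝ) < (b : ℝ) + 1 := by positivity
    have h := orbitSum_transfer_gibbsWeight_of_relBound (O := Λ) hH (spinSectorProj_conjTranspose a (b + 1))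
      (spinSectorProj_mul_self a (b + 1)) (spinSectorProj_mul_comm_of_preservesSectors hP a (b + 1))
      (fun x => annihilation (orb x 1)) hb1 hβ
      (sum_annihilation_down_conjTranspose_mul_mul_spinSectorProj a b)
      (fun w => re_rayleigh_orbitSum_annihilation_twoGraph_le G G' hΔ hΔ' t U t' U' 1 w)
    rw [sum_annihilation_down_mul_spinSectorProj_mul_conjTranspose, Matrix.smul_mul, Matrix.trace_smul,
      smul_eq_mul, Complex.re_ofReal_mul, re_trace_spinSectorProj_mul_gibbsWeight_eq hP,
      re_trace_spinSectorProj_mul_gibbsWeight_eq hP] at h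
    exact h

end TwoGraph

section Torus

/-- The torus rates: `4|t| + max(U,0) + (4|t'| + max(0,0)) = 4|t| + 4|t'| + max(U,0)`. [folklore] -/
private theorem torus_local_rate_eq (t t' U : ℝ) :
    ((4 : ℕ) : ℝ) * |t| + max U 0 + (((4 : ℕ) : ℝ) * |t'| + max (0 : ℝ) 0) = 4 * |t| + 4 * |t'| + max U 0 := by
  rw [max_self]; push_cast; ring

/-- The torus rates, removal: `4|t| + max(−U,0) + (4|t'| + max(−0,0)) = 4|t| + 4|t'| + max(−U,0)`. [folklore] -/
private theorem torus_local_rate_eq' (t t' U : ℝ) :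
    ((4 : ℕ) : ℝ) * |t| + max (-U) 0 + (((4 : ℕ) : ℝ) * |t'| + max (-(0 : ℝ)) 0) =
      4 * |t| + 4 * |t'| + max (-U) 0 := by
  rw [neg_zero, max_self]; push_cast; ring

/-- **Volume-free spin-up transfer on the `t–t'` torus** `ℤ/L₁ℤ × ℤ/L₂ℤ` (`|Λ| = L₁L₂`, `κ₊ = 4|t| + 4|t'| + U⁺`,
`κ₋ = 4|t| + 4|t'| + U⁻`, `β ≥ 0`, `k < L₁L₂`): `(|Λ| − k) Z(k,l) ≤ e^{βκ₊} (k+1) Z(k+1,l)` and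
`(k+1) Z(k+1,l) ≤ e^{βκ₋} (|Λ| − k) Z(k,l)`. [cite: Ruelle1969, §3.4] -/
theorem partitionFn_spinSector_hubbardRectTorusTT'_transfer_up_local (L₁ L₂ : ℕ) (t t' U : ℝ) {β : ℝ}
    (hβ : 0 ≤ β) {k : ℕ} (hk : k < L₁ * L₂) (l : ℕ) :
    (((L₁ * L₂ : ℕ) : ℝ) - k) * (partitionFn β (spinSectorHamiltonian k l (hubbardRectTorusTT' L₁ L₂ t t' U))).re ≤
        Real.exp (β * (4 * |t| + 4 * |t'| + max U 0)) *
          (((k : ℝ) + 1) * (partitionFn β (spinSectorHamiltonian (k + 1) l (hubbardRectTorusTT' L₁ L₂ t t' U))).re) ∧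
      ((k : ℝ) + 1) * (partitionFn β (spinSectorHamiltonian (k + 1) l (hubbardRectTorusTT' L₁ L₂ t t' U))).re ≤
        Real.exp (β * (4 * |t| + 4 * |t'| + max (-U) 0)) *
          ((((L₁ * L₂ : ℕ) : ℝ) - k) *
            (partitionFn β (spinSectorHamiltonian k l (hubbardRectTorusTT' L₁ L₂ t t' U))).re) := by
  have hk' : k < Fintype.card (Fin L₁ ×ₗ Fin L₂) := by rw [card_rectSites]; exact hk
  have h := partitionFn_spinSector_twoGraph_transfer_up_local (fermionRectTorusGraph L₁ L₂)
    (fermionRectTorusDiagGraph L₁ L₂) (card_filter_fermionRectTorusGraph_adj_le L₁ L₂)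
    (card_filter_fermionRectTorusDiagGraph_adj_le_four L₁ L₂) t U t' 0 hβ hk' l
  rw [torus_local_rate_eq, torus_local_rate_eq', card_rectSites] at h
  unfold hubbardRectTorusTT'
  exact h

/-- **Volume-free spin-down transfer on the `t–t'` torus** (`l < L₁L₂`). [cite: Ruelle1969, §3.4] -/
theorem partitionFn_spinSector_hubbardRectTorusTT'_transfer_down_local (L₁ L₂ : ℕ) (t t' U : ℝ) {β : ℝ}
    (hβ : 0 ≤ β) (k : ℕ) {l : ℕ} (hl : l < L₁ * L₂) :
    (((L₁ * L₂ : ℕ) : ℝ) - l) * (partitionFn β (spinSectorHamiltonian k l (hubbardRectTorusTT' L₁ L₂ t t' U))).re ≤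
        Real.exp (β * (4 * |t| + 4 * |t'| + max U 0)) *
          (((l : ℝ) + 1) * (partitionFn β (spinSectorHamiltonian k (l + 1) (hubbardRectTorusTT' L₁ L₂ t t' U))).re) ∧
      ((l : ℝ) + 1) * (partitionFn β (spinSectorHamiltonian k (l + 1) (hubbardRectTorusTT' L₁ L₂ t t' U))).re ≤
        Real.exp (β * (4 * |t| + 4 * |t'| + max (-U) 0)) *
          ((((L₁ * L₂ : ℕ) : ℝ) - l) *
            (partitionFn β (spinSectorHamiltonian k l (hubbardRectTorusTT' L₁ L₂ t t' U))).re) := by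
  have hl' : l < Fintype.card (Fin L₁ ×ₗ Fin L₂) := by rw [card_rectSites]; exact hl
  have h := partitionFn_spinSector_twoGraph_transfer_down_local (fermionRectTorusGraph L₁ L₂)
    (fermionRectTorusDiagGraph L₁ L₂) (card_filter_fermionRectTorusGraph_adj_le L₁ L₂)
    (card_filter_fermionRectTorusDiagGraph_adj_le_four L₁ L₂) t U t' 0 hβ k hl'
  rw [torus_local_rate_eq, torus_local_rate_eq', card_rectSites] at h
  unfold hubbardRectTorusTT'
  exact h

/-- **One up electron on the `t–t'` torus, volume-free logarithmic form** (`β ≥ 0`, `k + 1 ≤ L₁L₂`, `l ≤ L₁L₂`):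
`log((|Λ|−k)/(k+1)) − βκ₊ ≤ log Z(k+1,l) − log Z(k,l) ≤ log((|Λ|−k)/(k+1)) + βκ₋` — the free energy of one added
electron is the ideal lattice-gas entropy up to the band `[−κ₊, κ₋]`, `κ₊ = 4|t|+4|t'|+U⁺`, `κ₋ = 4|t|+4|t'|+U⁻`,
uniformly in the volume and the filling. [cite: Ruelle1969, §3.4] -/
theorem log_partitionFn_spinSector_hubbardRectTorusTT'_succ_up_mem_local (L₁ L₂ : ℕ) (t t' U : ℝ) {β : ℝ}
    (hβ : 0 ≤ β) {k l : ℕ} (hk : k + 1 ≤ L₁ * L₂) (hl : l ≤ L₁ * L₂) :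
    Real.log (((((L₁ * L₂ : ℕ) : ℝ) - k)) / ((k : ℝ) + 1)) - β * (4 * |t| + 4 * |t'| + max U 0) ≤
        Real.log (partitionFn β (spinSectorHamiltonian (k + 1) l (hubbardRectTorusTT' L₁ L₂ t t' U))).re -
          Real.log (partitionFn β (spinSectorHamiltonian k l (hubbardRectTorusTT' L₁ L₂ t t' U))).re ∧
      Real.log (partitionFn β (spinSectorHamiltonian (k + 1) l (hubbardRectTorusTT' L₁ L₂ t t' U))).re -
          Real.log (partitionFn β (spinSectorHamiltonian k l (hubbardRectTorusTT' L₁ L₂ t t' U))).re ≤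
        Real.log (((((L₁ * L₂ : ℕ) : ℝ) - k)) / ((k : ℝ) + 1)) + β * (4 * |t| + 4 * |t'| + max (-U) 0) := by
  have hH := hubbardRectTorusTT'_isHermitian L₁ L₂ t t' U
  have hcard : Fintype.card (Fin L₁ ×ₗ Fin L₂) = L₁ * L₂ := card_rectSites L₁ L₂
  haveI : Nonempty (Subtype (spinConfig (Λ := Fin L₁ ×ₗ Fin L₂) k l)) :=
    nonempty_spinConfig (by rw [hcard]; omega) (by rw [hcard]; exact hl)
  haveI : Nonempty (Subtype (spinConfig (Λ := Fin L₁ ×ₗ Fin L₂) (k + 1) l)) :=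
    nonempty_spinConfig (by rw [hcard]; exact hk) (by rw [hcard]; exact hl)
  have hZ := partitionFn_spinSector_re_pos (a := k) (b := l) hH β
  have hZ' := partitionFn_spinSector_re_pos (a := k + 1) (b := l) hH β
  have hm : (0 : ℝ) < (((L₁ * L₂ : ℕ) : ℝ) - k) := by
    have : ((k : ℝ) + 1) ≤ ((L₁ * L₂ : ℕ) : ℝ) := by exact_mod_cast hk
    linarith
  have hm' : (0 : ℝ) < (k : ℝ) + 1 := by positivity
  obtain ⟨h₁, h₂⟩ := partitionFn_spinSector_hubbardRectTorusTT'_transfer_up_local L₁ L₂ t t' U hβ (k := k)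
    (by omega) l
  exact log_sub_log_mem_of_transfer hm hm' hZ hZ' h₁ h₂

/-- **One down electron on the `t–t'` torus, volume-free logarithmic form** (`l + 1 ≤ L₁L₂`, `k ≤ L₁L₂`).
[cite: Ruelle1969, §3.4] -/
theorem log_partitionFn_spinSector_hubbardRectTorusTT'_succ_down_mem_local (L₁ L₂ : ℕ) (t t' U : ℝ) {β : ℝ}
    (hβ : 0 ≤ β) {k l : ℕ} (hk : k ≤ L₁ * L₂) (hl : l + 1 ≤ L₁ * L₂) :
    Real.log (((((L₁ * L₂ : ℕ) : ℝ) - l)) / ((l : ℝ) + 1)) - β * (4 * |t| + 4 * |t'| + max U 0) ≤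
        Real.log (partitionFn β (spinSectorHamiltonian k (l + 1) (hubbardRectTorusTT' L₁ L₂ t t' U))).re -
          Real.log (partitionFn β (spinSectorHamiltonian k l (hubbardRectTorusTT' L₁ L₂ t t' U))).re ∧
      Real.log (partitionFn β (spinSectorHamiltonian k (l + 1) (hubbardRectTorusTT' L₁ L₂ t t' U))).re -
          Real.log (partitionFn β (spinSectorHamiltonian k l (hubbardRectTorusTT' L₁ L₂ t t' U))).re ≤
        Real.log (((((L₁ * L₂ : ℕ) : ℝ) - l)) / ((l : ℝ) + 1)) + β * (4 * |t| + 4 * |t'| + max (-U) 0) := by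
  have hH := hubbardRectTorusTT'_isHermitian L₁ L₂ t t' U
  have hcard : Fintype.card (Fin L₁ ×ₗ Fin L₂) = L₁ * L₂ := card_rectSites L₁ L₂
  haveI : Nonempty (Subtype (spinConfig (Λ := Fin L₁ ×ₗ Fin L₂) k l)) :=
    nonempty_spinConfig (by rw [hcard]; exact hk) (by rw [hcard]; omega)
  haveI : Nonempty (Subtype (spinConfig (Λ := Fin L₁ ×ₗ Fin L₂) k (l + 1))) :=
    nonempty_spinConfig (by rw [hcard]; exact hk) (by rw [hcard]; exact hl)
  have hZ := partitionFn_spinSector_re_pos (a := k) (b := l) hH β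
  have hZ' := partitionFn_spinSector_re_pos (a := k) (b := l + 1) hH β
  have hm : (0 : ℝ) < (((L₁ * L₂ : ℕ) : ℝ) - l) := by
    have : ((l : ℝ) + 1) ≤ ((L₁ * L₂ : ℕ) : ℝ) := by exact_mod_cast hl
    linarith
  have hm' : (0 : ℝ) < (l : ℝ) + 1 := by positivity
  obtain ⟨h₁, h₂⟩ := partitionFn_spinSector_hubbardRectTorusTT'_transfer_down_local L₁ L₂ t t' U hβ k (l := l)
    (by omega)
  exact log_sub_log_mem_of_transfer hm hm' hZ hZ' h₁ h₂

/-- **One electron PAIR on the `t–t'` torus, volume-free form** (the diagonal step `(k,k) → (k+1,k+1)` of the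
canonical thermal convention; `k + 1 ≤ L₁L₂`):
`2 log((|Λ|−k)/(k+1)) − 2βκ₊ ≤ log Z(k+1,k+1) − log Z(k,k) ≤ 2 log((|Λ|−k)/(k+1)) + 2βκ₋`. [cite: Ruelle1969, §3.4] -/
theorem log_partitionFn_spinSector_hubbardRectTorusTT'_succ_succ_mem_local (L₁ L₂ : ℕ) (t t' U : ℝ) {β : ℝ}
    (hβ : 0 ≤ β) {k : ℕ} (hk : k + 1 ≤ L₁ * L₂) :
    2 * Real.log (((((L₁ * L₂ : ℕ) : ℝ) - k)) / ((k : ℝ) + 1)) - 2 * (β * (4 * |t| + 4 * |t'| + max U 0)) ≤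
        Real.log (partitionFn β (spinSectorHamiltonian (k + 1) (k + 1) (hubbardRectTorusTT' L₁ L₂ t t' U))).re -
          Real.log (partitionFn β (spinSectorHamiltonian k k (hubbardRectTorusTT' L₁ L₂ t t' U))).re ∧
      Real.log (partitionFn β (spinSectorHamiltonian (k + 1) (k + 1) (hubbardRectTorusTT' L₁ L₂ t t' U))).re -
          Real.log (partitionFn β (spinSectorHamiltonian k k (hubbardRectTorusTT' L₁ L₂ t t' U))).re ≤
        2 * Real.log (((((L₁ * L₂ : ℕ) : ℝ) - k)) / ((k : ℝ) + 1)) + 2 * (β * (4 * |t| + 4 * |t'| + max (-U) 0)) := by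
  obtain ⟨a₁, a₂⟩ := log_partitionFn_spinSector_hubbardRectTorusTT'_succ_up_mem_local L₁ L₂ t t' U hβ (l := k) hk
    (by omega)
  obtain ⟨b₁, b₂⟩ := log_partitionFn_spinSector_hubbardRectTorusTT'_succ_down_mem_local L₁ L₂ t t' U hβ
    (k := k + 1) hk hk
  constructor <;> linarith

/-! ### §4 The binomial entropy: the interaction part of the canonical free entropy is `2βκ`-Lipschitz -/

/-- `log C(M, k+1) − log C(M, k) = log((M − k)/(k + 1))` for `k + 1 ≤ M` (`C(M,k+1)(k+1) = C(M,k)(M−k)`).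
[folklore] -/
private theorem log_choose_succ_sub_log_choose {M k : ℕ} (hk : k + 1 ≤ M) :
    Real.log (M.choose (k + 1)) - Real.log (M.choose k) = Real.log ((((M : ℝ) - k)) / ((k : ℝ) + 1)) := by
  have hkM : k ≤ M := by omega
  have h := Nat.choose_succ_right_eq M k
  have hR : ((M.choose (k + 1) : ℕ) : ℝ) * ((k : ℝ) + 1) = ((M.choose k : ℕ) : ℝ) * ((M : ℝ) - k) := by
    rw [← Nat.cast_sub hkM]
    exact_mod_cast h
  have hc1 : (0 : ℝ) < ((M.choose (k + 1) : ℕ) : ℝ) := by exact_mod_cast Nat.choose_pos hk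
  have hc0 : (0 : ℝ) < ((M.choose k : ℕ) : ℝ) := by exact_mod_cast Nat.choose_pos hkM
  have hk1 : (0 : ℝ) < (k : ℝ) + 1 := by positivity
  have hMk : (0 : ℝ) < (M : ℝ) - k := by
    have : ((k : ℝ) + 1) ≤ (M : ℝ) := by exact_mod_cast hk
    linarith
  have hlog := congrArg Real.log hR
  rw [Real.log_mul hc1.ne' hk1.ne', Real.log_mul hc0.ne' hMk.ne'] at hlog
  rw [Real.log_div hMk.ne' hk1.ne']
  linarith

/-- **One pair against the binomial entropy** (`k + 1 ≤ L₁L₂ =: M`):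
`−2βκ₊ ≤ [log Z(k+1,k+1) − 2 log C(M,k+1)] − [log Z(k,k) − 2 log C(M,k)] ≤ 2βκ₋`. [cite: Ruelle1969, §3.4] -/
theorem log_partitionFn_sub_log_choose_pair_step_mem_local (L₁ L₂ : ℕ) (t t' U : ℝ) {β : ℝ} (hβ : 0 ≤ β)
    {k : ℕ} (hk : k + 1 ≤ L₁ * L₂) :
    -(2 * (β * (4 * |t| + 4 * |t'| + max U 0))) ≤
        (Real.log (partitionFn β (spinSectorHamiltonian (k + 1) (k + 1) (hubbardRectTorusTT' L₁ L₂ t t' U))).re -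
            2 * Real.log ((L₁ * L₂).choose (k + 1))) -
          (Real.log (partitionFn β (spinSectorHamiltonian k k (hubbardRectTorusTT' L₁ L₂ t t' U))).re -
            2 * Real.log ((L₁ * L₂).choose k)) ∧
      (Real.log (partitionFn β (spinSectorHamiltonian (k + 1) (k + 1) (hubbardRectTorusTT' L₁ L₂ t t' U))).re -
            2 * Real.log ((L₁ * L₂).choose (k + 1))) -
          (Real.log (partitionFn β (spinSectorHamiltonian k k (hubbardRectTorusTT' L₁ L₂ t t' U))).re -
            2 * Real.log ((L₁ * L₂).choose k)) ≤
        2 * (β * (4 * |t| + 4 * |t'| + max (-U) 0)) := by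
  obtain ⟨h₁, h₂⟩ := log_partitionFn_spinSector_hubbardRectTorusTT'_succ_succ_mem_local L₁ L₂ t t' U hβ hk
  have hc := log_choose_succ_sub_log_choose hk
  constructor <;> linarith

/-- **`d` pairs against the binomial entropy** (telescoped; `S + d ≤ L₁L₂ =: M`):
`−2βκ₊ d ≤ [log Z(S+d,S+d) − 2 log C(M,S+d)] − [log Z(S,S) − 2 log C(M,S)] ≤ 2βκ₋ d` — the interaction part of
the canonical free entropy is `2βκ`-Lipschitz in the pair number, uniformly in the volume. [cite: Ruelle1969, §3.4] -/
theorem log_partitionFn_sub_log_choose_pairs_mem_local (L₁ L₂ : ℕ) (t t' U : ℝ) {β : ℝ} (hβ : 0 ≤ β) :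
    ∀ (d S : ℕ), S + d ≤ L₁ * L₂ →
      -(2 * (β * (4 * |t| + 4 * |t'| + max U 0)) * d) ≤
          (Real.log (partitionFn β (spinSectorHamiltonian (S + d) (S + d) (hubbardRectTorusTT' L₁ L₂ t t' U))).re -
              2 * Real.log ((L₁ * L₂).choose (S + d))) -
            (Real.log (partitionFn β (spinSectorHamiltonian S S (hubbardRectTorusTT' L₁ L₂ t t' U))).re -
              2 * Real.log ((L₁ * L₂).choose S)) ∧
        (Real.log (partitionFn β (spinSectorHamiltonian (S + d) (S + d) (hubbardRectTorusTT' L₁ L₂ t t' U))).re -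
              2 * Real.log ((L₁ * L₂).choose (S + d))) -
            (Real.log (partitionFn β (spinSectorHamiltonian S S (hubbardRectTorusTT' L₁ L₂ t t' U))).re -
              2 * Real.log ((L₁ * L₂).choose S)) ≤
          2 * (β * (4 * |t| + 4 * |t'| + max (-U) 0)) * d := by
  intro d
  induction d with
  | zero =>
      intro S _
      simp
  | succ d ih =>
      intro S hSd
      obtain ⟨i₁, i₂⟩ := ih (S + 1) (by omega)
      obtain ⟨s₁, s₂⟩ := log_partitionFn_sub_log_choose_pair_step_mem_local L₁ L₂ t t' U hβ (k := S) (by omega)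
      have e : S + 1 + d = S + (d + 1) := by ring
      rw [e] at i₁ i₂
      push_cast
      constructor <;> linarith

end Torus

end ThermodynamicLimit

end Literature.MathematicalPhysics.QuantumLattice
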